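import Literature.Analysis.FluidPDE.KwonMollifiedDriftSmooth
import Literature.Analysis.FluidPDE.KwonDriftBounds
import HarnessLib

/-!
# Kwon's time-mollified drift: spatial derivative, divergence on `B₁`, uniform bounds

Analysis/FluidPDE proof file (theorems only) on the discharge path of the named fact
`Literature.Analysis.FluidPDE.kwon2023_velocity_epsilon_regularity`
(`PressureFreeEpsilonRegularity.lean`; H. Kwon, J. Differential Equations (2023) =
arXiv:2104.03160, Thm. 1.4). Continuing `KwonMollifiedDriftSmooth` (the time-mollified drift
`h_ρ(t,x) = ∫ ρ(τ) h(t − τ, x) dτ`, `h = driftField W`, is jointly smooth), this file records the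
elementary calculus of `h_ρ` used by the local energy step of Lemma 2.5 (design memo
`kits/A4-R1b-localEnergy-design-ser-a-g8.md`, (O1)–(O3)):

* `Kwon2023.hasFDerivAt_timeConv_driftField` — the spatial derivative of `h_ρ(t,·)` is the
  time mollification of `Dh = driftGrad W` (differentiation under the integral, dominated by the
  uniform bound (est.h), `k = 1`);
* `Kwon2023.divergence_timeConv_driftField_eq_zero` — `div_x h_ρ(t,·) = 0` on `B₁` for every `t`
  (`div h(s,·) = 0` on `B₁`, Remark 2.3 (2.3));
* `Kwon2023.exists_norm_timeConv_driftField_le`, `Kwon2023.exists_norm_fderiv_timeConv_driftField_le`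
  — `sup |h_ρ| ≤ M`, `sup |D_x h_ρ| ≤ M` with `M` independent of the bump `ρ` ((est.h), `k = 0, 1`,
  and `∫ρ = 1`).

No NS-regularity statement is touched.

## Mathlib / tree search

Tree (reused): `driftField`, `driftGrad`, `contDiff_driftField`, `stronglyMeasurable_uncurry_driftField`,
`stronglyMeasurable_uncurry_driftGrad` (`KwonSpaceTimeFields`); `exists_forall_norm_driftField_le`,
`exists_forall_norm_driftGrad_le` (`KwonDriftBounds`); `divergence_harmonicPart_eq_zero`
(`KwonHarmonicPart`); `FunctionSpaces.norm_normed_convolution_le_of_bound` (`TimeMollification`). Mathlib: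
`hasFDerivAt_integral_of_dominated_of_fderiv_le`, `ContinuousLinearMap.integral_comp_comm`,
`ContDiffBump.integrable_normed`, `convolution_def`.

## References

* H. Kwon, *The role of the pressure in the regularity theory for the Navier–Stokes equations*,
  J. Differential Equations 357 (2023) = arXiv:2104.03160: Remark 2.3 (2.3)–(2.4) (est.h) and
  Lemma 2.5 (proof, p. 8–9). [Kwon2023RolePressure]
-/

noncomputable section

open MeasureTheory Set Function Filter Topology TopologicalSpace Metric InnerProductSpace
  ContinuousLinearMap
open scoped NNReal ENNReal RealInnerProductSpace Convolution ContDiff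

namespace Literature.Analysis.FluidPDE

namespace Kwon2023

variable {W : ℝ → EuclideanSpace ℝ (Fin 3) → EuclideanSpace ℝ (Fin 3)}

/-! ### Measurability of the time slices at a fixed point -/

/-- `τ ↦ h(t − τ, y)` is strongly measurable. [folklore] -/
private theorem stronglyMeasurable_driftField_timeSlice (hW : IsGoodVelocity W) (t : ℝ)
    (y : EuclideanSpace ℝ (Fin 3)) : StronglyMeasurable (fun τ : ℝ => driftField W (t - τ) y) := by
  have hg : Measurable (fun τ : ℝ => ((t - τ, y) : ℝ × EuclideanSpace ℝ (Fin 3))) :=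
    (measurable_const.sub measurable_id).prodMk measurable_const
  have h0 := (stronglyMeasurable_uncurry_driftField hW).comp_measurable hg
  have e : (uncurry (driftField W) ∘ fun τ : ℝ => ((t - τ, y) : ℝ × EuclideanSpace ℝ (Fin 3))) =
      fun τ => driftField W (t - τ) y := by
    funext τ; simp only [Function.comp_apply, Function.uncurry_apply_pair]
  rw [e] at h0
  exact h0

/-- `τ ↦ Dh(t − τ, y)` is strongly measurable. [folklore] -/
private theorem stronglyMeasurable_driftGrad_timeSlice (hW : IsGoodVelocity W) (t : ℝ)
    (y : EuclideanSpace ℝ (Fin 3)) : StronglyMeasurable (fun τ : ℝ => driftGrad W (t - τ) y) := by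
  have hg : Measurable (fun τ : ℝ => ((t - τ, y) : ℝ × EuclideanSpace ℝ (Fin 3))) :=
    (measurable_const.sub measurable_id).prodMk measurable_const
  have h0 := (stronglyMeasurable_uncurry_driftGrad hW).comp_measurable hg
  have e : (uncurry (driftGrad W) ∘ fun τ : ℝ => ((t - τ, y) : ℝ × EuclideanSpace ℝ (Fin 3))) =
      fun τ => driftGrad W (t - τ) y := by
    funext τ; simp only [Function.comp_apply, Function.uncurry_apply_pair]
  rw [e] at h0
  exact h0

/-! ### The spatial derivative of the mollified drift -/

/-- **Differentiation under the time integral**: for every `t`, the slice `x ↦ h_ρ(t,x)` of the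
time-mollified drift has derivative `∫ ρ(τ) Dh(t − τ, x) dτ`, the time mollification of
`Dh = driftGrad W` (the slices `h(s,·)` are smooth with `sup|Dh| ≤ M`, (est.h) `k = 1`).
[cite: Kwon2023RolePressure, Remark 2.3 (2.4) and Lemma 2.5 (est.h)] -/
theorem hasFDerivAt_timeConv_driftField (hW : IsGoodVelocity W) (φ : ContDiffBump (0 : ℝ)) (t : ℝ)
    (x : EuclideanSpace ℝ (Fin 3)) :
    HasFDerivAt (fun y => (φ.normed volume ⋆[lsmul ℝ ℝ, volume] fun σ => driftField W σ y) t)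
      ((φ.normed volume ⋆[lsmul ℝ ℝ, volume] fun σ => driftGrad W σ x) t) x := by
  obtain ⟨M, hM⟩ := exists_forall_norm_driftField_le hW
  obtain ⟨M', hM'⟩ := exists_forall_norm_driftGrad_le hW
  have hρi : Integrable (φ.normed volume) (volume : Measure ℝ) := φ.integrable_normed
  have hρc : Continuous (φ.normed volume) := φ.continuous_normed
  -- the integrands
  have hmeasF : ∀ y : EuclideanSpace ℝ (Fin 3),
      AEStronglyMeasurable (fun τ : ℝ => φ.normed volume τ • driftField W (t - τ) y) volume := fun y =>
    hρc.aestronglyMeasurable.smul (stronglyMeasurable_driftField_timeSlice hW t y).aestronglyMeasurable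
  have hmeasF' : AEStronglyMeasurable (fun τ : ℝ => φ.normed volume τ • driftGrad W (t - τ) x) volume :=
    hρc.aestronglyMeasurable.smul (stronglyMeasurable_driftGrad_timeSlice hW t x).aestronglyMeasurable
  have hintF : Integrable (fun τ : ℝ => φ.normed volume τ • driftField W (t - τ) x) := by
    refine (hρi.norm.mul_const M).mono' (hmeasF x) (Eventually.of_forall fun τ => ?_)
    rw [norm_smul]
    exact mul_le_mul_of_nonneg_left (hM _ _) (norm_nonneg _)
  have key := hasFDerivAt_integral_of_dominated_of_fderiv_le (μ := (volume : Measure ℝ))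
    (F := fun (y : EuclideanSpace ℝ (Fin 3)) (τ : ℝ) => φ.normed volume τ • driftField W (t - τ) y)
    (F' := fun (y : EuclideanSpace ℝ (Fin 3)) (τ : ℝ) => φ.normed volume τ • driftGrad W (t - τ) y)
    (x₀ := x) (bound := fun τ => ‖φ.normed volume τ‖ * M') univ_mem
    (Eventually.of_forall hmeasF) hintF hmeasF'
    (Eventually.of_forall fun τ y _ => by
      rw [norm_smul]
      exact mul_le_mul_of_nonneg_left (hM' _ _) (norm_nonneg _))
    (hρi.norm.mul_const M')
    (Eventually.of_forall fun τ y _ => by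
      have hd : HasFDerivAt (driftField W (t - τ)) (driftGrad W (t - τ) y) y :=
        (((contDiff_driftField hW (t - τ) (n := 1)).differentiable (by simp)) y).hasFDerivAt
      exact hd.const_smul (φ.normed volume τ))
  have e1 : (fun y => (φ.normed volume ⋆[lsmul ℝ ℝ, volume] fun σ => driftField W σ y) t) =
      fun y => ∫ τ, φ.normed volume τ • driftField W (t - τ) y := by
    funext y; simp only [convolution_def, lsmul_apply]
  have e2 : (φ.normed volume ⋆[lsmul ℝ ℝ, volume] fun σ => driftGrad W σ x) t =
      ∫ τ, φ.normed volume τ • driftGrad W (t - τ) x := by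
    simp only [convolution_def, lsmul_apply]
  rw [e1, e2]
  exact key

/-- The spatial derivative of the mollified drift, as an `fderiv` identity.
[cite: Kwon2023RolePressure, Remark 2.3 (2.4) and Lemma 2.5 (est.h)] -/
theorem fderiv_timeConv_driftField (hW : IsGoodVelocity W) (φ : ContDiffBump (0 : ℝ)) (t : ℝ)
    (x : EuclideanSpace ℝ (Fin 3)) :
    fderiv ℝ (fun y => (φ.normed volume ⋆[lsmul ℝ ℝ, volume] fun σ => driftField W σ y) t) x =
      (φ.normed volume ⋆[lsmul ℝ ℝ, volume] fun σ => driftGrad W σ x) t :=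
  (hasFDerivAt_timeConv_driftField hW φ t x).fderiv

/-! ### The mollified drift is divergence free on `B₁` -/

/-- The trace as a continuous linear functional on operators of `ℝ³`. [folklore] -/
private theorem divergence_eq_traceCLM (v : EuclideanSpace ℝ (Fin 3) → EuclideanSpace ℝ (Fin 3))
    (x : EuclideanSpace ℝ (Fin 3)) :
    VectorCalculus.divergence v x =
      (LinearMap.toContinuousLinearMap ((LinearMap.trace ℝ (EuclideanSpace ℝ (Fin 3))).comp
        (ContinuousLinearMap.coeLM ℝ))) (fderiv ℝ v x) := rfl

/-- **`div_x h_ρ(t,·) = 0` on `B₁`** for every `t`: the divergence passes under the time integral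
and `div h(s,·) = 0` on `B₁` for every `s` (Remark 2.3: `h` is a curl plus a gradient of a
harmonic function there). [cite: Kwon2023RolePressure, Remark 2.3 (2.3)] -/
theorem divergence_timeConv_driftField_eq_zero (hW : IsGoodVelocity W) (φ : ContDiffBump (0 : ℝ)) (t : ℝ)
    {x : EuclideanSpace ℝ (Fin 3)} (hx : ‖x‖ < 1) :
    VectorCalculus.divergence (fun y => (φ.normed volume ⋆[lsmul ℝ ℝ, volume] fun σ => driftField W σ y) t) x = 0 := by
  set T := LinearMap.toContinuousLinearMap ((LinearMap.trace ℝ (EuclideanSpace ℝ (Fin 3))).comp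
    (ContinuousLinearMap.coeLM ℝ)) with hT
  obtain ⟨M', hM'⟩ := exists_forall_norm_driftGrad_le hW
  have hρi : Integrable (φ.normed volume) (volume : Measure ℝ) := φ.integrable_normed
  have hint : Integrable (fun τ : ℝ => φ.normed volume τ • driftGrad W (t - τ) x) := by
    refine (hρi.norm.mul_const M').mono' (φ.continuous_normed.aestronglyMeasurable.smul
      (stronglyMeasurable_driftGrad_timeSlice hW t x).aestronglyMeasurable) (Eventually.of_forall fun τ => ?_)
    rw [norm_smul]
    exact mul_le_mul_of_nonneg_left (hM' _ _) (norm_nonneg _)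
  have hdiv : ∀ s, T (driftGrad W s x) = 0 := by
    intro s
    rw [← show VectorCalculus.divergence (driftField W s) x = T (driftGrad W s x) from
      divergence_eq_traceCLM _ _]
    exact divergence_harmonicPart_eq_zero (integrable_scalarDensity (hW.integrableOn_slice s)).locallyIntegrable
      (integrable_vectorDensity (hW.integrableOn_slice s)).locallyIntegrable hx
  rw [divergence_eq_traceCLM, fderiv_timeConv_driftField hW φ t x]
  simp only [convolution_def, lsmul_apply]
  rw [← T.integral_comp_comm hint]
  simp [map_smul, hdiv]

/-! ### Uniform bounds -/

/-- **`sup |h_ρ| ≤ M` uniformly in the bump** ((est.h) `k = 0` and `∫ρ = 1`).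
[cite: Kwon2023RolePressure, Remark 2.3 (2.4) and Lemma 2.5 (est.h)] -/
theorem exists_norm_timeConv_driftField_le (hW : IsGoodVelocity W) :
    ∃ M : ℝ, ∀ (φ : ContDiffBump (0 : ℝ)) t x,
      ‖(φ.normed volume ⋆[lsmul ℝ ℝ, volume] fun σ => driftField W σ x) t‖ ≤ M := by
  obtain ⟨M, hM⟩ := exists_forall_norm_driftField_le hW
  exact ⟨M, fun φ t x => FunctionSpaces.norm_normed_convolution_le_of_bound
    (V := EuclideanSpace ℝ (Fin 3)) φ (h := fun σ => driftField W σ x) (fun σ => hM σ x) t⟩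

/-- **`sup |D_x h_ρ| ≤ M` uniformly in the bump** ((est.h) `k = 1` and `∫ρ = 1`).
[cite: Kwon2023RolePressure, Remark 2.3 (2.4) and Lemma 2.5 (est.h)] -/
theorem exists_norm_fderiv_timeConv_driftField_le (hW : IsGoodVelocity W) :
    ∃ M : ℝ, ∀ (φ : ContDiffBump (0 : ℝ)) t x,
      ‖fderiv ℝ (fun y => (φ.normed volume ⋆[lsmul ℝ ℝ, volume] fun σ => driftField W σ y) t) x‖ ≤ M := by
  obtain ⟨M, hM⟩ := exists_forall_norm_driftGrad_le hW
  refine ⟨M, fun φ t x => ?_⟩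
  rw [fderiv_timeConv_driftField hW φ t x]
  simp only [convolution_def, lsmul_apply]
  have hρi : Integrable (φ.normed volume) (volume : Measure ℝ) := φ.integrable_normed
  calc ‖∫ τ, φ.normed volume τ • driftGrad W (t - τ) x‖
      ≤ ∫ τ, φ.normed volume τ * M := by
        refine norm_integral_le_of_norm_le (hρi.mul_const M) (Eventually.of_forall fun τ => ?_)
        rw [norm_smul, Real.norm_of_nonneg (φ.nonneg_normed τ)]
        exact mul_le_mul_of_nonneg_left (hM _ _) (φ.nonneg_normed τ)
    _ = M := by rw [integral_mul_const, φ.integral_normed, one_mul]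

end Kwon2023

end Literature.Analysis.FluidPDE

end
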